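import Summits.CriticalPhenomena.PercolationContinuityZ3.Theorems.Transplant.SkelFrmFrom1RootHoldsQ3VNode
import Summits.CriticalPhenomena.PercolationContinuityZ3.Theorems.Transplant.SkelFrmFrom1ReachHoldsQ3VNode
import Summits.CriticalPhenomena.PercolationContinuityZ3.Theorems.Transplant.SkelFrmFrom1FaceHoldsQ3VNode
import Summits.CriticalPhenomena.PercolationContinuityZ3.Theorems.Transplant.SkelFrmFromBChoiceGeomV
import Summits.CriticalPhenomena.PercolationContinuityZ3.Theorems.Transplant.SkelFrmFrom1ChoiceLTK
import Summits.CriticalPhenomena.PercolationContinuityZ3.Theorems.Transplant.SkelFrmFrom1Closure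
import Summits.CriticalPhenomena.PercolationContinuityZ3.Theorems.Transplant.PlanarSkeletonFrmFrom1
import Summits.CriticalPhenomena.PercolationContinuityZ3.Theorems.Transplant.PlanarSkeletonFrmFromDefs
import HarnessLib

/-!
# RUNG U NODE FILE (RULING D-U W2, lead g21; staged by the design owner p3-g26 2026-08-26 per the lead's 15:42Z request; filed ONLY after «NODE READY (U)» +
# «PROBE PASS» under the protocol of record — W2-VACANT / G-U1 name the filer): **the single-type frames-only node FROM WIDTH ℓ₀ holds** —
# `SamePDropOfSkeletonFrmFrom₁` by the FOUR PORTED COLUMNS of the U wave, composed exactly as N2's node «SkelFrm1HoldsAllL» (term = lead probe (2) VERBATIM)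

builds on p205010 (kernel theorem, internal audit signed; external expert review pending).  PROVENANCE (W2): this file is the N2 node term of record
(`Transplant.samePDropOfSkeletonFrm₁_holds`, «SkelFrm1HoldsAllL») with every name twinned onto the carrier `PlanarSkeletonFrmFrom` by the U-wave registry
(WAVE-U-TWIN-REGISTRY-v3.1; policy T: `LfQ` stays `PlanarSkeletonFrm.NegB.LfQ`), i.e. the closure `PlanarSkeletonFrmFrom.samePDropOfSkeletonFrmFrom₁_of_choiceFnNQLTK`
at `Lf := LfQ`, `dT := (·^3)`, `Kmin := 480`, the choice function `PlanarSkeletonFrmFrom.frmChoiceAllQ3V` at the node tuple of record, and the four column theorems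
Geom `PlanarSkeletonFrmFrom.geomHoldsNQFn_frmChoiceAllQ3V` (W1 idx 81) · (R) `PlanarSkeletonFrmFrom.NegB.rootHoldsNQWFnLK_frmChoiceAllQ3V_node` (idx 224) ·
(F) `PlanarSkeletonFrmFrom.NegB.faceHoldsRNQFnLTK_frmChoiceAllQ3V` (idx 237) · (C) `PlanarSkeletonFrmFrom.reachHoldsRHNQFnLK_frmChoiceAllQ3V` (idx 223).  It is the
term of the lead's probe «FrmFrom1FourOfFourByNameProbe_g21.lean» (sha 2d907b15…) item (2), VERBATIM.  No mathematics lives here: the U wave is a binder wave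
((κ) `cyl_connected` is read only at LEVEL 0‴ — `PlanarSkeletonFrmFrom1`/«SkelPhiStepIFrQFrom» — and nowhere in the columns; P3-NILPOTENT §19.0–19.4).
§2 gives the normal forms customers cite: at criticality (`…_iff_critical`), minimal (`…_iff_minimal'`, «SkelFrmFrom1Closure»), and the customers' one-liners
`continuity_of_frmFromNode₁` / `…₁'` DISCHARGED.  Until this file is ACCEPTED nothing about `SamePDropOfSkeletonFrmFrom₁` is claimed anywhere.
[cite: BenjaminiSchramm1996, Conj. 4] [cite: KozmaNitzan2024, §4 (Lemma 8, Lemma 12, Step IV)] [cite: Hutchcroft2016, Thm. 1] [cite: LyonsPeres2016, Thm. 7.6]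
-/

noncomputable section

namespace Summit.CriticalPhenomena.PercolationContinuityZ3.Theorems

namespace Transplant

open MeasureTheory Literature.Probability.Percolation Literature.Probability.LatticeModels SimpleGraph
open scoped Classical

/-! ## §1 The node -/

/-- **THE SINGLE-TYPE FRAMES-ONLY NODE FROM WIDTH ℓ₀ HOLDS**: `SamePDropOfSkeletonFrmFrom₁` — for every connected, locally finite, countable graph carrying a
`PlanarSkeletonFrmFrom` with one base vertex type `t`, every `p < 1` with a.s. uniqueness, subcritical cylinders and `θ_t(p) > 0` admits `q < p` with `θ_t(q) > 0`.
The four-of-four composition of the U wave's ported columns (term = lead probe g21 (2) verbatim; W2 provenance in the file header).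
builds on p205010 (kernel theorem, internal audit signed; external expert review pending). [cite: BenjaminiSchramm1996, Conj. 4] [cite: KozmaNitzan2024, §4] -/
theorem samePDropOfSkeletonFrmFrom₁_holds : SamePDropOfSkeletonFrmFrom₁ :=
  PlanarSkeletonFrmFrom.samePDropOfSkeletonFrmFrom₁_of_choiceFnNQLTK PlanarSkeletonFrm.NegB.LfQ (fun x : ℝ => x ^ 3) (fun _ hx => pow_pos hx 3) 480
    (PlanarSkeletonFrmFrom.frmChoiceAllQ3V
      (PlanarSkeletonFrmFrom.NegB.KS.gT 0 (PlanarSkeletonFrmFrom.NegB.gxQ 0 (PlanarSkeletonFrmFrom.NegB.gxR0 0) (PlanarSkeletonFrmFrom.NegB.fxR 0)))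
      (PlanarSkeletonFrmFrom.NegB.KS.fT 0 (PlanarSkeletonFrmFrom.NegB.fxQ 0 (PlanarSkeletonFrmFrom.NegB.fxR 0)))
      (PlanarSkeletonFrmFrom.NegB.KS.PR 0 (PlanarSkeletonFrmFrom.NegB.PxQ 0 (PlanarSkeletonFrmFrom.NegB.PxR 0)))
      (PlanarSkeletonFrmFrom.NegB.SUS (PlanarSkeletonFrmFrom.NegB.exQ 0 (PlanarSkeletonFrmFrom.NegB.exR0 0)) (PlanarSkeletonFrmFrom.NegB.mxQ (PlanarSkeletonFrmFrom.NegB.mxF 0)))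
      (PlanarSkeletonFrmFrom.NegB.cR2W 0) (PlanarSkeletonFrmFrom.NegB.hFR 0) PlanarSkeletonFrmFrom.NegB.BSlot.small3)
    (PlanarSkeletonFrmFrom.geomHoldsNQFn_frmChoiceAllQ3V _ _ _ _ _ _ _)
    (PlanarSkeletonFrmFrom.NegB.rootHoldsNQWFnLK_frmChoiceAllQ3V_node 480 0 (by norm_num) (PlanarSkeletonFrmFrom.NegB.mxF 0))
    (PlanarSkeletonFrmFrom.NegB.faceHoldsRNQFnLTK_frmChoiceAllQ3V 480 le_rfl 0 (PlanarSkeletonFrmFrom.NegB.gxR0 0) (PlanarSkeletonFrmFrom.NegB.fxR 0)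
      (PlanarSkeletonFrmFrom.NegB.exR0 0) (PlanarSkeletonFrmFrom.NegB.PxR 0))
    (PlanarSkeletonFrmFrom.reachHoldsRHNQFnLK_frmChoiceAllQ3V 480 (by norm_num) (PlanarSkeletonFrmFrom.NegB.gxR0 0) (PlanarSkeletonFrmFrom.NegB.fxR 0)
      (PlanarSkeletonFrmFrom.NegB.exR0 0) (PlanarSkeletonFrmFrom.NegB.mxF 0) (PlanarSkeletonFrmFrom.NegB.PxR 0))

/-! ## §2 The normal forms -/

/-- **The node AT CRITICALITY** (normal form `samePDropOfSkeletonFrmFrom₁_iff_critical`): on every connected, locally finite, countable graph with a one-type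
`PlanarSkeletonFrmFrom`, `p_c(G,t) < 1`, a.s. uniqueness at `p_c` and subcritical cylinders at `p_c` give `θ_t(p_c) = 0`.
builds on p205010 (kernel theorem, internal audit signed; external expert review pending). [cite: BenjaminiSchramm1996, Conj. 4] -/
theorem frmFrom₁CriticalContinuity_critical_holds :
    ∀ {V : Type} [DecidableEq V] [Countable V] (G : SimpleGraph V) [G.LocallyFinite] (Φ : PlanarSkeletonFrmFrom G),
      G.Connected → ∀ t ∈ Φ.types, Φ.types = {t} → criticalProb G t < 1 →
        (∀ᵐ ω ∂bondPercolation G (criticalProbIOf G t), numInfiniteClusters ω ≤ 1) →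
          Φ.CylSubcritical (criticalProbIOf G t) → theta G t (criticalProbIOf G t) = 0 :=
  samePDropOfSkeletonFrmFrom₁_iff_critical.1 samePDropOfSkeletonFrmFrom₁_holds

/-- **THE NODE IN MINIMAL FORM HOLDS** (normal form `samePDropOfSkeletonFrmFrom₁_iff_minimal'`, «SkelFrmFrom1Closure»): `θ_t(p_c(G,t)) = 0`
for EVERY locally finite graph carrying a `PlanarSkeletonFrmFrom` with one base vertex type `t` and subcritical cylinders at `p_c` — connectedness, countability,
quasi-transitivity, uniqueness and `p_c < 1` come from the skeleton.
builds on p205010 (kernel theorem, internal audit signed; external expert review pending).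
[cite: BenjaminiSchramm1996, Conj. 4] [cite: Hutchcroft2016, Thm. 1] [cite: LyonsPeres2016, Thm. 7.6] -/
theorem frmFrom₁CriticalContinuity_minimal_holds :
    ∀ {V : Type} (G : SimpleGraph V) [G.LocallyFinite] (Φ : PlanarSkeletonFrmFrom G), ∀ t ∈ Φ.types, Φ.types = {t} →
      Φ.CylSubcritical (criticalProbIOf G t) → theta G t (criticalProbIOf G t) = 0 :=
  samePDropOfSkeletonFrmFrom₁_iff_minimal'.1 samePDropOfSkeletonFrmFrom₁_holds

/-- **THE CUSTOMERS' ONE-LINER, DISCHARGED** (`continuity_of_frmFromNode₁` with its hypothesis `hD` supplied by §1): on a connected locally finite graph with a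
one-type `PlanarSkeletonFrmFrom` and subcritical cylinders at `p_c`, `θ_t(p_c) = 0`.
builds on p205010 (kernel theorem, internal audit signed; external expert review pending). [cite: BenjaminiSchramm1996, Conj. 4] -/
theorem frmFrom₁CriticalContinuity_holds {V : Type} (G : SimpleGraph V) [G.LocallyFinite] (Φ : PlanarSkeletonFrmFrom G) (hc : G.Connected) (t : V)
    (ht : t ∈ Φ.types) (h1 : Φ.types = {t}) (hC : Φ.CylSubcritical (criticalProbIOf G t)) : theta G t (criticalProbIOf G t) = 0 :=
  continuity_of_frmFromNode₁ samePDropOfSkeletonFrmFrom₁_holds G Φ hc t ht h1 hC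

/-- **The customers' one-liner with connectedness from the skeleton** (`continuity_of_frmFromNode₁'`, «PlanarSkeletonFrmFrom1»), DISCHARGED.
builds on p205010 (kernel theorem, internal audit signed; external expert review pending). [cite: BenjaminiSchramm1996, Conj. 4] -/
theorem frmFrom₁CriticalContinuity_holds' {V : Type} (G : SimpleGraph V) [G.LocallyFinite] (Φ : PlanarSkeletonFrmFrom G) (t : V)
    (ht : t ∈ Φ.types) (h1 : Φ.types = {t}) (hC : Φ.CylSubcritical (criticalProbIOf G t)) : theta G t (criticalProbIOf G t) = 0 :=
  continuity_of_frmFromNode₁' samePDropOfSkeletonFrmFrom₁_holds G Φ t ht h1 hC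

end Transplant

end Summit.CriticalPhenomena.PercolationContinuityZ3.Theorems

end
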